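import Summits.BirchSwinnertonDyer.BirchSwinnertonDyer.Theorems.GenusKolyvaginAtTwoShaCardDvdPowAtTwoRTShaAnnihilation
import Literature.NumberTheory.EllipticCurves.SelmerGroupCardinality
import Literature.NumberTheory.EllipticCurves.LeadingTermProofs
import HarnessLib

/-!
# Route `GenusKolyvaginAtTwo`, crux U_T `ShaCardDvdPowAtTwoRT` (stmt-BirchSwinnertonDyer-23658) —
# U_T IN SELMER CURRENCY: `rank E(K) = 1` and `#Sel_{2^N}(E/K) = 2^N · #Ш(E/K)[2^∞]` for `N ≥ M₀ + 2` on the habitat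

Seat `bsd-line-gk2-p4` g22 (WIDTH-5 attach, cell `bsd-f1-sign2`), `--supports stmt-BirchSwinnertonDyer-23658` (helper; closes nothing).
THEOREMS ONLY (no definition, no named fact, no `sorry`).  BSD is NOT proved by any of this; U_T is NOT proved: this file turns its
conclusion `#Ш(E/K)[2^∞] ∣ 2^{2M₀}` into the EQUIVALENT order statement `#Sel_{2^{M₀+2}}(E/K) ∣ 2^{3M₀+2}` about one finite Selmer group.

WHAT (U_T's habitat, modulo the antecedent Q2 `KolyvaginRelationAtTwo`; sequel of `…RTShaAnnihilation`, p746927):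
* `mordellWeilRank_baseChange_eq_one_onHabitat` — `rank_ℤ E(K) = 1` (`≤ 1`: gk2-p4 g21 `mordellWeilRank_baseChange_le_one_onHabitat`,
  Kolyvagin's descent at `2`; `≥ 1`: `P(1) = y_K ∈ E(K)` has infinite order);
* `natCard_selmerGroup_eq_two_pow_mul_natCard_sha_onHabitat` — for every `N ≥ M₀ + 2`: `#Sel_{2^N}(E/K) = 2^N · #Ш(E/K)[2^∞]`
  (descent count `#Sel_n = n^{rank} · #E(K)[n] · #Ш[n]`, tree `card_selmerGroup_eq_pow_rank_mul`; `E(K)[2] = 0`; `Ш[2^N] = Ш[2^∞]` because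
  `2^{M₀+2}` kills `Ш[2^∞]`, `sha_primaryComponent_two_onHabitat`);
* `natCard_sha_dvd_iff_natCard_selmerGroup_dvd_onHabitat` — **U_T's bound `#Ш(E/K)[2^∞] ∣ 2^{2M₀}` ⟺ `#Sel_{2^{M₀+2}}(E/K) ∣ 2^{3M₀+2}`**.

References: [SilvermanAEC2009] Thm. X.4.2(a), VIII.6; [McCallumLMS1991] §1 Theorem; [GrossLMS1991] §1–§2; [Kolyvagin1990] Thm. A.
-/

set_option autoImplicit false
-- the Theorems namespace of this sub repeats the summit name by design (D-0017 nested layout)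
set_option linter.dupNamespace false

noncomputable section

open scoped Classical
open scoped AddSubgroup

namespace Summit.BirchSwinnertonDyer.BirchSwinnertonDyer.Theorems.GenusExact.PlusDescent

open WeierstrassCurve NumberField IsDedekindDomain Field Literature.NumberTheory.EllipticCurves
  Literature.NumberTheory.GaloisRepresentations Literature.NumberTheory.EllipticCurves.ModularForms AddSubgroup
open Summit.BirchSwinnertonDyer.BirchSwinnertonDyer.Theses.GenusKolyvaginAtTwo (KolyvaginRelationAtTwo)
open Summit.BirchSwinnertonDyer.Rank1Residual

/-! ## The count in Selmer currency: `#Sel_{2^N}(E/K) = 2^N · #Ш(E/K)[2^∞]` for `N ≥ M₀ + 2` -/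

/-- **`rank_ℤ E(K) = 1` on U_T's habitat** (modulo Q2): `≤ 1` is gk2-p4 g21's `mordellWeilRank_baseChange_le_one_onHabitat` (Kolyvagin's
descent at `2`), `≥ 1` because `P(1) = y_K ∈ E(K)` has infinite order (Mordell–Weil + an injective `ℤ → E(K)`).
[cite: Kolyvagin1990, Thm. A] [cite: GrossLMS1991, §1 Thm. 1.3 (1)] -/
theorem mordellWeilRank_baseChange_eq_one_onHabitat (hQ2 : KolyvaginRelationAtTwo)
    (W : WeierstrassCurve ℚ) [W.IsElliptic] [W.IsGloballyMinimal] [NeZero (W.conductorNorm ℤ)] (hcm : ¬ W.HasCM)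
    (hT : Odd W.tamagawaProduct) (v : HeightOneSpectrum (𝓞 ℚ)) (h2v : ((2 : ℕ) : 𝓞 ℚ) ∉ v.asIdeal)
    (hNv : ((W.conductorNorm ℤ : ℕ) : 𝓞 ℚ) ∈ v.asIdeal) (hmult : W.HasMultiplicativeReductionAt v) (hneg : W.Δ < 0)
    (K : Type) [Field K] [NumberField K] (hIQ : IsImaginaryQuadratic K) (hodd : Odd (NumberField.discr K))
    (h3 : NumberField.discr K ≠ -3) (hHe : SatisfiesHeegnerHypothesis (W.conductorNorm ℤ) K)
    (hsq1 : ¬ IsSquare ((NumberField.discr K : ℚ) * -|W.Δ|)) (hsq2 : ¬ IsSquare ((NumberField.discr K : ℚ) * (-(2 * |W.Δ|))))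
    (hρ : ∀ n : ℕ, 0 < n → W.HasSurjectiveModNGaloisRep ((2 : ℤ) ^ n))
    (Dt : ModularParametrizationData W (W.conductorNorm ℤ)) (β : ℤ) (ι : K →+* ℂ) (d₁ : KolyvaginHeegnerData Dt β ι 1)
    (hnt : ¬ IsOfFinAddOrder d₁.derivedPoint) (M₀ : ℕ)
    (hndiv : ¬ ∃ Q : (W.baseChange (ringClassField K ι 1)).toAffine.Point, ((2 ^ (M₀ + 1) : ℕ) : ℤ) • Q = d₁.derivedPoint) :
    (W.baseChange K).mordellWeilRank = 1 := by
  haveI hell : (W.baseChange K).IsElliptic := inferInstanceAs ((W.map (algebraMap ℚ K)).IsElliptic)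
  have hle := mordellWeilRank_baseChange_le_one_onHabitat hQ2 W hcm hT v h2v hNv hmult hneg K hIQ hodd h3 hHe hsq1 hsq2 hρ Dt β ι d₁
    M₀ hndiv
  obtain ⟨Ph, -, hPhmap⟩ := AdditiveKoly.exists_isHeegnerPoint_map_eq_derivedPoint_one (W := W) (K := K) (Dt := Dt) (β := β)
    (ι := ι) hIQ hHe d₁
  have hPh : ¬ IsOfFinAddOrder Ph := fun h ↦ hnt (by rw [← hPhmap]; exact AddMonoidHom.isOfFinAddOrder _ h)
  have hge := one_le_mordellWeilRank_of_not_isOfFinAddOrder (W.baseChange K) (W.baseChange K).module_finite_point_holds hPh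
  omega

/-- **U_T in Selmer currency: `#Sel_{2^N}(E/K) = 2^N · #Ш(E/K)[2^∞]` for every `N ≥ M₀ + 2`** on U_T's habitat (modulo Q2).  The descent
count `#Sel_{2^N} = 2^{N·rank} · #E(K)[2^N] · #(Ш ⊓ H¹(K,E)[2^N])` (tree `card_selmerGroup_eq_pow_rank_mul`, Silverman X.4.2(a) + Mordell–Weil)
with `rank E(K) = 1` (`mordellWeilRank_baseChange_eq_one_onHabitat`), `E(K)[2^N] = 0` (`ρ̄_{E,2}` onto), and `Ш ⊓ H¹(K,E)[2^N] = Ш[2^∞]`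
as soon as `2^N` kills `Ш[2^∞]`, i.e. for `N ≥ M₀ + 2` (`sha_primaryComponent_two_onHabitat`).  Hence U_T's bound `#Ш(E/K)[2^∞] ∣ 2^{2M₀}`
is EQUIVALENT to `#Sel_{2^{M₀+2}}(E/K) ∣ 2^{3M₀+2}` (`natCard_sha_dvd_iff_natCard_selmerGroup_dvd_onHabitat`).
[cite: SilvermanAEC2009, Thm. X.4.2(a), VIII.6] [cite: McCallumLMS1991, §1 Theorem] [cite: GrossLMS1991, §2] -/
theorem natCard_selmerGroup_eq_two_pow_mul_natCard_sha_onHabitat (hQ2 : KolyvaginRelationAtTwo)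
    (W : WeierstrassCurve ℚ) [W.IsElliptic] [W.IsGloballyMinimal] [NeZero (W.conductorNorm ℤ)] (hcm : ¬ W.HasCM)
    (hT : Odd W.tamagawaProduct) (v : HeightOneSpectrum (𝓞 ℚ)) (h2v : ((2 : ℕ) : 𝓞 ℚ) ∉ v.asIdeal)
    (hNv : ((W.conductorNorm ℤ : ℕ) : 𝓞 ℚ) ∈ v.asIdeal) (hmult : W.HasMultiplicativeReductionAt v) (hneg : W.Δ < 0)
    (K : Type) [Field K] [NumberField K] (hIQ : IsImaginaryQuadratic K) (hodd : Odd (NumberField.discr K))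
    (h3 : NumberField.discr K ≠ -3) (hHe : SatisfiesHeegnerHypothesis (W.conductorNorm ℤ) K)
    (hsq1 : ¬ IsSquare ((NumberField.discr K : ℚ) * -|W.Δ|)) (hsq2 : ¬ IsSquare ((NumberField.discr K : ℚ) * (-(2 * |W.Δ|))))
    (hρ : ∀ n : ℕ, 0 < n → W.HasSurjectiveModNGaloisRep ((2 : ℤ) ^ n))
    (Dt : ModularParametrizationData W (W.conductorNorm ℤ)) (β : ℤ) (ι : K →+* ℂ) (d₁ : KolyvaginHeegnerData Dt β ι 1)
    (hnt : ¬ IsOfFinAddOrder d₁.derivedPoint) (M₀ : ℕ)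
    (hndiv : ¬ ∃ Q : (W.baseChange (ringClassField K ι 1)).toAffine.Point, ((2 ^ (M₀ + 1) : ℕ) : ℤ) • Q = d₁.derivedPoint)
    (N : ℕ) (hN : M₀ + 2 ≤ N) :
    Nat.card (selmerGroup (W.baseChange K) ((2 ^ N : ℕ) : ℤ)) = 2 ^ N * Nat.card (AddCommGroup.primaryComponent (W.baseChange K).sha 2) := by
  haveI : Fact (Nat.Prime 2) := ⟨Nat.prime_two⟩
  haveI hell : (W.baseChange K).IsElliptic := inferInstanceAs ((W.map (algebraMap ℚ K)).IsElliptic)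
  haveI : NeZero (2 ^ N) := ⟨pow_ne_zero _ two_ne_zero⟩
  have h2 : Module.finrank ℚ K = 2 := hIQ.1
  have hs2 : W.HasSurjectiveModNGaloisRep 2 := by simpa using hρ 1 one_pos
  -- rank one
  have hrank := mordellWeilRank_baseChange_eq_one_onHabitat hQ2 W hcm hT v h2v hNv hmult hneg K hIQ hodd h3 hHe hsq1 hsq2 hρ Dt β ι d₁ hnt
    M₀ hndiv
  -- no rational `2`-power torsion
  have htors : torsionBy (W.baseChange K).toAffine.Point (((2 ^ N : ℕ) : ℕ) : ℤ) = ⊥ := by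
    refine (AddSubgroup.eq_bot_iff_forall _).mpr fun P hP ↦ ?_
    have hP' : ((2 ^ N : ℕ) : ℤ) • P = 0 := by simpa using hP
    exact EigenClassesFinite.forall_zsmul_two_pow_baseChange_eq_zero_of_hasSurjectiveModNGaloisRep_two W K h2 hs2 N P
      (by exact_mod_cast hP')
  -- `Ш ⊓ H¹(K,E)[2^N] = Ш[2^∞]` for `N ≥ M₀ + 2`
  obtain ⟨-, hkill, -⟩ := sha_primaryComponent_two_onHabitat hQ2 W hcm hT v h2v hNv hmult hneg K hIQ hodd h3 hHe hsq1 hsq2 hρ Dt β ι d₁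
    M₀ hndiv
  have hkillN : ∀ c ∈ AddCommGroup.primaryComponent (W.baseChange K).sha 2, 2 ^ N • c = 0 := by
    intro c hc
    obtain ⟨e, he⟩ := Nat.exists_eq_add_of_le hN
    rw [he, pow_add, mul_nsmul, hkill c hc, nsmul_zero]
  have hcardT : Nat.card ((W.baseChange K).sha ⊓ torsionBy (W.baseChange K).galH1 (((2 ^ N : ℕ) : ℕ) : ℤ) :
      AddSubgroup (W.baseChange K).galH1) = Nat.card (AddCommGroup.primaryComponent (W.baseChange K).sha 2) := by
    refine Nat.card_congr
      { toFun := fun x ↦ ⟨⟨x.1, (AddSubgroup.mem_inf.mp x.2).1⟩, (AddCommGroup.mem_primaryComponent).mpr ⟨N, ?_⟩⟩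
        invFun := fun c ↦ ⟨((c.1 : (W.baseChange K).sha) : (W.baseChange K).galH1), AddSubgroup.mem_inf.mpr ⟨c.1.2, ?_⟩⟩
        left_inv := fun _ ↦ rfl
        right_inv := fun _ ↦ rfl }
    · have hx : ((2 ^ N : ℕ) : ℤ) • (x.1 : (W.baseChange K).galH1) = 0 := by
        have := (AddSubgroup.mem_inf.mp x.2).2
        exact this
      apply Subtype.ext
      rw [AddSubgroupClass.coe_nsmul, ZeroMemClass.coe_zero, ← natCast_zsmul]
      exact hx
    · have hc : 2 ^ N • (c.1 : (W.baseChange K).sha) = 0 := hkillN c.1 c.2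
      change ((2 ^ N : ℕ) : ℤ) • ((c.1 : (W.baseChange K).sha) : (W.baseChange K).galH1) = 0
      rw [natCast_zsmul, ← AddSubgroupClass.coe_nsmul, hc, ZeroMemClass.coe_zero]
  -- the descent count
  have hcount := Literature.NumberTheory.EllipticCurves.card_selmerGroup_eq_pow_rank_mul (W.baseChange K) (2 ^ N)
  rw [hrank, pow_one, htors, AddSubgroup.card_bot, mul_one, hcardT] at hcount
  exact hcount

/-- **U_T ⟺ a Selmer count at ONE level**: on U_T's habitat (modulo Q2), `#Ш(E/K)[2^∞] ∣ 2^{2M₀}` iff `#Sel_{2^{M₀+2}}(E/K) ∣ 2^{3M₀+2}`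
(`natCard_selmerGroup_eq_two_pow_mul_natCard_sha_onHabitat` at `N = M₀ + 2`).  For the U_T planners: the order statement of Kolyvagin's
theorem at `2` is exactly the ORDER of one finite Selmer group. [cite: McCallumLMS1991, §1 Theorem] [cite: SilvermanAEC2009, Thm. X.4.2(a)] -/
theorem natCard_sha_dvd_iff_natCard_selmerGroup_dvd_onHabitat (hQ2 : KolyvaginRelationAtTwo)
    (W : WeierstrassCurve ℚ) [W.IsElliptic] [W.IsGloballyMinimal] [NeZero (W.conductorNorm ℤ)] (hcm : ¬ W.HasCM)
    (hT : Odd W.tamagawaProduct) (v : HeightOneSpectrum (𝓞 ℚ)) (h2v : ((2 : ℕ) : 𝓞 ℚ) ∉ v.asIdeal)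
    (hNv : ((W.conductorNorm ℤ : ℕ) : 𝓞 ℚ) ∈ v.asIdeal) (hmult : W.HasMultiplicativeReductionAt v) (hneg : W.Δ < 0)
    (K : Type) [Field K] [NumberField K] (hIQ : IsImaginaryQuadratic K) (hodd : Odd (NumberField.discr K))
    (h3 : NumberField.discr K ≠ -3) (hHe : SatisfiesHeegnerHypothesis (W.conductorNorm ℤ) K)
    (hsq1 : ¬ IsSquare ((NumberField.discr K : ℚ) * -|W.Δ|)) (hsq2 : ¬ IsSquare ((NumberField.discr K : ℚ) * (-(2 * |W.Δ|))))
    (hρ : ∀ n : ℕ, 0 < n → W.HasSurjectiveModNGaloisRep ((2 : ℤ) ^ n))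
    (Dt : ModularParametrizationData W (W.conductorNorm ℤ)) (β : ℤ) (ι : K →+* ℂ) (d₁ : KolyvaginHeegnerData Dt β ι 1)
    (hnt : ¬ IsOfFinAddOrder d₁.derivedPoint) (M₀ : ℕ)
    (hndiv : ¬ ∃ Q : (W.baseChange (ringClassField K ι 1)).toAffine.Point, ((2 ^ (M₀ + 1) : ℕ) : ℤ) • Q = d₁.derivedPoint) :
    Nat.card (AddCommGroup.primaryComponent (W.baseChange K).sha 2) ∣ 2 ^ (2 * M₀) ↔
      Nat.card (selmerGroup (W.baseChange K) ((2 ^ (M₀ + 2) : ℕ) : ℤ)) ∣ 2 ^ (3 * M₀ + 2) := by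
  rw [natCard_selmerGroup_eq_two_pow_mul_natCard_sha_onHabitat hQ2 W hcm hT v h2v hNv hmult hneg K hIQ hodd h3 hHe hsq1 hsq2 hρ Dt β ι d₁ hnt
    M₀ hndiv (M₀ + 2) le_rfl]
  have hpow : 2 ^ (3 * M₀ + 2) = 2 ^ (M₀ + 2) * 2 ^ (2 * M₀) := by rw [← pow_add]; congr 1; omega
  rw [hpow]
  exact (Nat.mul_dvd_mul_iff_left (by positivity)).symm

end Summit.BirchSwinnertonDyer.BirchSwinnertonDyer.Theorems.GenusExact.PlusDescent

end
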